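import Summits.Ventures.QEC.Census.CertCheckBZMitmSound
import Summits.Ventures.QEC.Census.CertCheckBZAutSound
import HarnessLib

/-!
# Soundness of the meet-in-the-middle replay, III: one block, one `bz_aut` side, `DistCert` bridges, Steane control

* `block_sound_mitm` — SAME CONCLUSION as `CertCheckBZSound.block_sound` (type-10): structural side data +
  allow-list + (per matrix `matrixSysOK`, the block's relative-rank bound, every meet-in-the-middle part at threshold
  `target − 1`) ⇒ every non-trivial logical whose label lies in `span W_b` has weight `≥ target`
  (`bz_block` of type-07 with `henum_of_mitm`);
* `bzAut_lower_sound_mitm` — SAME CONCLUSION and same core/transport/cover hypotheses as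
  `CertCheckBZAutSound.bzAut_lower_sound`; the per-block `bzBlockOK` verdicts (enumeration scans) are replaced by
  ℕ-indexed families of KERNEL facts: `matrixSysOK` (tree: `bzZSys`), the bound (tree: `bzZBound`) and the
  meet-in-the-middle parts (tree: `bzZMitm`, `decide +kernel`);
* `DistCert.matrixSysOK_of_bzZSys` / `le_of_bzZBound` / `mitmPart_of_bzZMitm` (+ `X` twins): the `DistCert`
  words of the part files unpacked to these hypotheses;
* control (closing `example`): the Steane certificate through `bzAut_lower_sound_mitm` (one block, no automorphisms).

Tier KERNEL (axioms standard); no distance value is asserted. qec-search-9 (g2); reuses the word lemmas of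
`Census/CertMitmLemmas.lean` (qec-type-07 g3), `Census/CertSystematicWeight.lean` and `Census/CertMitmLayers.lean`
(qec-type-11 / qec-type-01), and the byte-parallel popcount of `Census/CertPopcount.lean` (qec-search-10 / qec-type-10).
-/

namespace Summit.Ventures.QEC.Census

/-! ## Soundness, part 4: one block and one side (`bz_block`, `bz_cover`) from the meet-in-the-middle parts -/

section Block

open Matrix Finset Literature.InformationTheory.QuantumCodes Literature.InformationTheory.Coding

variable {n : ℕ} {Hsyn Hstab : List ℕ} {rcY rcS : RankCert} {L Ld : List ℕ} {found : List (ℕ × List ℕ)}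

/-- **One block, enumeration by meet in the middle** (same conclusion as `CertCheckBZSound.block_sound`): if the
side's structural data checks (rank certificates, pairing, dimension), the allow-list decomposes, every matrix of
block `blk` is systematic with rows `< 2^n` (`matrixSysOK`), the block's relative-rank bound reaches `target`, and
EVERY PART of the meet-in-the-middle replay of every matrix at threshold `target − 1` passes, then every non-trivial
logical whose label lies in `span W_blk` has weight `≥ target`.  (`block_sound` with `henum_of_mitm` in place of
`henum_of_matrixOK`.) -/
theorem block_sound_mitm (hn : 0 < n) (hcomm : rowMatrix n Hsyn * (rowMatrix n Hstab)ᵀ = 0)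
    (hY : rcY.check n Hsyn = true) (hS : rcS.check n Hstab = true) (hL : logOK n Hsyn Hstab L Ld = true)
    (hdim : n = rcY.r + rcS.r + L.length) (hfound : foundOK Hstab found = true) {target : ℕ} (blk : BZBlock)
    (hsysm : ∀ i : Fin blk.mats.length, matrixSysOK n (gbRows Hstab rcS L blk) (blk.mats[i]) = true)
    (hbd : target ≤ bzBoundList n (gbRows Hstab rcS L blk).length blk.mats 0)
    (hmitm : ∀ (i : Fin blk.mats.length) (p : ℕ), p < mitmParts (target - 1) →
      mitmPart n (target - 1) (found.map Prod.fst) (gbRows Hstab rcS L blk) (blk.mats[i]) p = true)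
    (hlen : (blk.mats.all fun mt => mt.A.length == (gbRows Hstab rcS L blk).length) = true)
    {z : Fin n → ZMod 2} (hz : rowMatrix n Hsyn *ᵥ z = 0) (hz' : z ∉ rowSpace (rowMatrix n Hstab))
    (hlab : ldMat n L Ld *ᵥ z ∈
      Submodule.span (ZMod 2) (Set.range fun l : Fin blk.W.length => ofBits L.length blk.W[l])) :
    target ≤ hammingNorm z := by
  rcases Nat.eq_zero_or_pos target with h0 | htpos
  · omega
  simp only [List.all_eq_true, beq_iff_eq] at hlen
  set Gb := gbRows Hstab rcS L blk with hGb
  have hAlen : ∀ i : Fin blk.mats.length, (giRows Gb (blk.mats[i])).length = Gb.length := fun i => by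
    rw [giRows, List.length_map]
    exact hlen _ (List.getElem_mem i.2)
  have hsysOK : ∀ i : Fin blk.mats.length, systematicOK n (giRows Gb (blk.mats[i])) (blk.mats[i]).T = true :=
    fun i => by
      have := hsysm i
      simp only [matrixSysOK, Bool.and_eq_true] at this
      exact this.1
  have hTlen : ∀ i : Fin blk.mats.length, (blk.mats[i]).T.length = Gb.length := fun i => by
    have := hsysOK i
    simp only [systematicOK, Bool.and_eq_true, beq_iff_eq] at this
    rw [← this.1.1, hAlen i]
  have hTlt : ∀ (i : Fin blk.mats.length) (q : ℕ), q ∈ (blk.mats[i]).T → q < n := fun i q hq => by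
    have := hsysOK i
    simp only [systematicOK, Bool.and_eq_true, List.all_eq_true, decide_eq_true_eq] at this
    exact this.1.2 q hq
  -- the CSS code of the side
  let C := CSSCode.ofMatrices (rowMatrix n Hsyn) (rowMatrix n Hstab) hcomm
  have hlt := bz_block C (L := logVec n L) (Ld := ldMat n L Ld)
    (fun j => mulVec_dual_eq_zero hL j) (fun i j => dual_dotProduct_logVec hL i j)
    (fun w hw => exists_coeffs_of_ker hcomm hY hS hL hdim hw)
    (kb := Gb.length) (Gb := fun j => rowMatrix n Gb j)
    (by rw [← rowSpace_rowMatrix_eq_span]; exact rowSpace_le_span_gbRows hS L blk)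
    (W := fun l : Fin blk.W.length => ofBits L.length blk.W[l])
    (fun l => by rw [← rowSpace_rowMatrix_eq_span]; exact sum_smul_logVec_mem_span_gbRows n Hstab rcS L blk l)
    (m := blk.mats.length) (G := fun i => rowFun n (giRows Gb (blk.mats[i])) Gb.length)
    (T := fun i => colFun hn (blk.mats[i]).T Gb.length)
    (fun i j j' => hsys_of_systematicOK hn (hsysOK i) (hTlen i) j j')
    (fun i j => by rw [← rowSpace_rowMatrix_eq_span]; exact rowFun_giRows_mem Gb _ _ j)
    (t := fun i => (blk.mats[i]).t) (wmax := target - 1)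
    (fun i a ha1 hat haw => henum_of_mitm hfound (hsysm i) (hmitm i) (hAlen i) a ha1 hat haw)
    (by rw [← bzBoundList_eq_bzBound hn hTlt hTlen]; omega)
    hz hz' hlab
  omega

end Block

section Side

open Matrix Finset Literature.InformationTheory.QuantumCodes Literature.InformationTheory.Coding

variable {n : ℕ} {Hsyn Hstab : List ℕ} {rcY rcS : RankCert} {L Ld : List ℕ} {found : List (ℕ × List ℕ)}
  {wmax : ℕ} {s : BZSide}

/-- **One side, method `bz_aut`, enumeration by meet in the middle** (same conclusion and same structural, transport
and cover hypotheses as `CertCheckBZAutSound.bzAut_lower_sound`; the per-block `bzBlockOK` verdicts are replaced by: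
every matrix systematic (`matrixSysOK`, KERNEL), every block bound (KERNEL), every meet-in-the-middle part (KERNEL,
`decide +kernel`)) ⇒ every `z ∈ ker Hsyn ∖ rowspace Hstab` has weight `> wmax`. -/
theorem bzAut_lower_sound_mitm (hcomm : rowMatrix n Hsyn * (rowMatrix n Hstab)ᵀ = 0)
    (hfound : foundOK Hstab found = true) (hcore : bzCoreOK n Hsyn Hstab rcY rcS L Ld s.evenWitness = true)
    (hlen : bzLenOK Hstab rcS L s = true)
    (hsysb : ∀ (b i : ℕ) (hb : b < s.blocks.length) (hi : i < (s.blocks[b]).mats.length),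
      matrixSysOK n (gbRows Hstab rcS L s.blocks[b]) ((s.blocks[b]).mats[i]) = true)
    (hbdb : ∀ (b : ℕ) (hb : b < s.blocks.length),
      wEff wmax s.evenWitness + 1 ≤ bzBoundList n (gbRows Hstab rcS L s.blocks[b]).length (s.blocks[b]).mats 0)
    (hmb : ∀ (b i p : ℕ) (hb : b < s.blocks.length) (hi : i < (s.blocks[b]).mats.length),
      p < mitmParts (wEff wmax s.evenWitness) →
        mitmPart n (wEff wmax s.evenWitness) (found.map Prod.fst) (gbRows Hstab rcS L s.blocks[b])
          ((s.blocks[b]).mats[i]) p = true)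
    {α : Type*} (φ : α → (Fin n → ZMod 2) → (Fin n → ZMod 2))
    (ρ : α → Matrix (Fin L.length) (Fin L.length) (ZMod 2))
    (hφ : ∀ a (z : Fin n → ZMod 2), rowMatrix n Hsyn *ᵥ z = 0 → z ∉ rowSpace (rowMatrix n Hstab) →
      rowMatrix n Hsyn *ᵥ φ a z = 0 ∧ φ a z ∉ rowSpace (rowMatrix n Hstab) ∧
        hammingNorm (φ a z) = hammingNorm z ∧ ldMat n L Ld *ᵥ φ a z = ρ a *ᵥ (ldMat n L Ld *ᵥ z))
    (hcover : ∀ lam : Fin L.length → ZMod 2, lam ≠ 0 →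
      (∃ b : Fin s.blocks.length, lam ∈ Submodule.span (ZMod 2)
        (Set.range fun l : Fin (s.blocks[b]).W.length => ofBits L.length (s.blocks[b]).W[l])) ∨
      ∃ (a : α) (b : Fin s.blocks.length), ρ a *ᵥ lam ∈ Submodule.span (ZMod 2)
        (Set.range fun l : Fin (s.blocks[b]).W.length => ofBits L.length (s.blocks[b]).W[l]))
    (w : Fin n → ZMod 2) (hw : rowMatrix n Hsyn *ᵥ w = 0) (hw' : w ∉ rowSpace (rowMatrix n Hstab)) :
    wmax < hammingNorm w := by
  rcases Nat.eq_zero_or_pos n with hn0 | hn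
  · subst hn0
    exfalso
    apply hw'
    have : w = 0 := funext fun i => i.elim0
    rw [this]
    exact Submodule.zero_mem _
  simp only [bzCoreOK, Bool.and_eq_true, beq_iff_eq] at hcore
  obtain ⟨⟨⟨⟨hY, hS⟩, hL⟩, hdim⟩, hpar⟩ := hcore
  simp only [bzLenOK, List.all_eq_true] at hlen
  let C := CSSCode.ofMatrices (rowMatrix n Hsyn) (rowMatrix n Hstab) hcomm
  have hblock : ∀ (b : Fin s.blocks.length) (z : Fin n → ZMod 2), rowMatrix n Hsyn *ᵥ z = 0 →
      z ∉ rowSpace (rowMatrix n Hstab) → ldMat n L Ld *ᵥ z ∈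
        ((Submodule.span (ZMod 2) (Set.range fun l : Fin (s.blocks[b]).W.length =>
          ofBits L.length (s.blocks[b]).W[l]) : Submodule (ZMod 2) (Fin L.length → ZMod 2)) : Set _) →
      wEff wmax s.evenWitness < hammingNorm z := by
    intro b z hz hz' hlab
    have hlenb : ((s.blocks[b]).mats.all fun mt => mt.A.length == (gbRows Hstab rcS L (s.blocks[b])).length) =
        true := by
      rw [List.all_eq_true]
      exact hlen _ (List.getElem_mem b.2)
    have := block_sound_mitm hn hcomm hY hS hL hdim hfound (target := wEff wmax s.evenWitness + 1) (s.blocks[b])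
      (fun i => hsysb b i b.2 i.2) (hbdb b b.2) (fun i p hp => hmb b i p b.2 i.2 (by simpa using hp)) hlenb hz hz'
      hlab
    omega
  have key : wEff wmax s.evenWitness < hammingNorm w :=
    bz_cover C (L := logVec n L) (Ld := ldMat n L Ld) (fun j => mulVec_dual_eq_zero hL j)
      (fun i j => dual_dotProduct_logVec hL i j) (fun z hz => exists_coeffs_of_ker hcomm hY hS hL hdim hz)
      (fun b : Fin s.blocks.length => ((Submodule.span (ZMod 2) (Set.range fun l : Fin (s.blocks[b]).W.length =>
          ofBits L.length (s.blocks[b]).W[l]) : Submodule (ZMod 2) (Fin L.length → ZMod 2)) : Set _))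
      hblock φ ρ hφ
      (fun lam hlam => by
        rcases hcover lam hlam with ⟨b, hb'⟩ | ⟨a, b, hab⟩
        · exact Or.inl ⟨b, hb'⟩
        · exact Or.inr ⟨a, b, hab⟩)
      hw hw'
  cases hew : s.evenWitness with
  | none => simpa [wEff, hew] using key
  | some sel =>
    rw [hew] at key hpar
    simp only [parityPartOK] at hpar
    exact lt_hammingNorm_of_even C (fun z hz => even_hammingNorm_of_parityOK hpar hz) hw
      (by simpa [wEff] using key)

end Side

/-! ## Bridges from the `DistCert` words (the shapes of the BB144 part files) -/

namespace DistCert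

variable (c : DistCert) (z : BZData)

/-- `bzZSys` at an existing (block, matrix) is `matrixSysOK`. -/
theorem matrixSysOK_of_bzZSys {b i : ℕ} (hb : b < z.sideZ.blocks.length) (hi : i < (z.sideZ.blocks[b]).mats.length)
    (h : c.bzZSys z b i = true) :
    matrixSysOK c.n (gbRows c.HZ z.rcZ z.LZ z.sideZ.blocks[b]) ((z.sideZ.blocks[b]).mats[i]) = true := by
  simpa [bzZSys, List.getElem?_eq_getElem hb, List.getElem?_eq_getElem hi] using h

/-- `bzZBound` at an existing block is the relative-rank bound. -/
theorem le_of_bzZBound {b : ℕ} (hb : b < z.sideZ.blocks.length) (h : c.bzZBound z b = true) :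
    wEff (c.dZ - 1) z.sideZ.evenWitness + 1 ≤
      bzBoundList c.n (gbRows c.HZ z.rcZ z.LZ z.sideZ.blocks[b]).length (z.sideZ.blocks[b]).mats 0 := by
  simpa [bzZBound, List.getElem?_eq_getElem hb] using h

/-- `bzZMitm` at an existing (block, matrix) is the meet-in-the-middle part. -/
theorem mitmPart_of_bzZMitm {b i p : ℕ} (hb : b < z.sideZ.blocks.length)
    (hi : i < (z.sideZ.blocks[b]).mats.length) (h : c.bzZMitm z b i p = true) :
    mitmPart c.n (wEff (c.dZ - 1) z.sideZ.evenWitness) (c.sideZ.found.map Prod.fst)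
      (gbRows c.HZ z.rcZ z.LZ z.sideZ.blocks[b]) ((z.sideZ.blocks[b]).mats[i]) p = true := by
  simpa [bzZMitm, List.getElem?_eq_getElem hb, List.getElem?_eq_getElem hi] using h

/-- `bzXSys` at an existing (block, matrix) is `matrixSysOK`. -/
theorem matrixSysOK_of_bzXSys {b i : ℕ} (hb : b < z.sideX.blocks.length) (hi : i < (z.sideX.blocks[b]).mats.length)
    (h : c.bzXSys z b i = true) :
    matrixSysOK c.n (gbRows c.HX z.rcX z.LX z.sideX.blocks[b]) ((z.sideX.blocks[b]).mats[i]) = true := by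
  simpa [bzXSys, List.getElem?_eq_getElem hb, List.getElem?_eq_getElem hi] using h

/-- `bzXBound` at an existing block is the relative-rank bound. -/
theorem le_of_bzXBound {b : ℕ} (hb : b < z.sideX.blocks.length) (h : c.bzXBound z b = true) :
    wEff (c.dX - 1) z.sideX.evenWitness + 1 ≤
      bzBoundList c.n (gbRows c.HX z.rcX z.LX z.sideX.blocks[b]).length (z.sideX.blocks[b]).mats 0 := by
  simpa [bzXBound, List.getElem?_eq_getElem hb] using h

/-- `bzXMitm` at an existing (block, matrix) is the meet-in-the-middle part. -/
theorem mitmPart_of_bzXMitm {b i p : ℕ} (hb : b < z.sideX.blocks.length)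
    (hi : i < (z.sideX.blocks[b]).mats.length) (h : c.bzXMitm z b i p = true) :
    mitmPart c.n (wEff (c.dX - 1) z.sideX.evenWitness) (c.sideX.found.map Prod.fst)
      (gbRows c.HX z.rcX z.LX z.sideX.blocks[b]) ((z.sideX.blocks[b]).mats[i]) p = true := by
  simpa [bzXMitm, List.getElem?_eq_getElem hb, List.getElem?_eq_getElem hi] using h

end DistCert

/-! ## Control: the Steane `bz` certificate through the meet-in-the-middle side theorem (kernel, no automorphisms) -/

section Control

open Matrix Literature.InformationTheory.QuantumCodes

/-- Sanity check of the hypothesis shapes of `bzAut_lower_sound_mitm` on the Steane certificate of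
`Census/CertCheckBZ.lean` (one block, `α = Empty`, plain cover): every `Z`-logical has weight `> 2` (`d_Z ≥ 3`),
all parts by `decide`.  (An `example`: the statement coincides with `steane_bzAut_noAut`.) -/
example (w : Fin 7 → ZMod 2) (hw : rowMatrix 7 certSteane7.HX *ᵥ w = 0)
    (hw' : w ∉ rowSpace (rowMatrix 7 certSteane7.HZ)) : 2 < hammingNorm w :=
  bzAut_lower_sound_mitm (rcY := bzSteane.rcX) (rcS := bzSteane.rcZ) (L := bzSteane.LZ) (Ld := bzSteane.LX)
    (found := certSteane7.sideZ.found) (s := bzSteane.sideZ) (wmax := 2)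
    (comm_of_commOK (by decide)) (by decide) (by decide) (by decide)
    (fun b i hb hi => by
      have hb' : b = 0 := by simpa [bzSteane] using hb
      subst hb'
      have hi' : i ≤ 1 := by simpa [bzSteane] using hi
      interval_cases i <;> decide +revert)
    (fun b hb => by
      have hb' : b = 0 := by simpa [bzSteane] using hb
      subst hb'
      decide +revert)
    (fun b i p hb hi hp => by
      have hb' : b = 0 := by simpa [bzSteane] using hb
      subst hb'
      have hi' : i ≤ 1 := by simpa [bzSteane] using hi
      have hp' : p ≤ 1 := by simpa [bzSteane, mitmParts, wEff] using hp
      interval_cases i <;> interval_cases p <;> decide +revert)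
    (α := Empty) (fun a => a.elim) (fun a => a.elim) (fun a => a.elim)
    (fun lam hlam => Or.inl (exists_block_of_coverOK (by decide) lam hlam)) w hw hw'

end Control

end Summit.Ventures.QEC.Census
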